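import Mathlib

/-!
# Venture YMGap, track Y3 FLOW-DATA — the SECANT-CONVEX certificate (theorems only)

HONEST FRAMING: venture file of the cell `pub-ymgap` (QuantumFields programme), track Y3, lineage B (flow-eng-2) and
lineage A (flow-eng-1) both publish «SECANT-CONVEX» plaquette rows: a certified enclosure of a DERIVATIVE
`F'(β)` (times `1/N`) of a CONVEX, differentiable function `F` (`F(β_t, β_s) = lim (1/n) log Z_n` of the anisotropic
Wilson action — convexity by Hölder, differentiability from the simplicity of the top transfer-matrix eigenvalue,
`∂F/∂β_t = N_ℓ P_t`, `∂F/∂β_s = N_sp P_s` by Hellmann–Feynman; those three physics premises are NOT proved here and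
enter the rows as named premises) obtained from certified ENCLOSURES of `F` at `β`, `β - h₁`, `β + h₂` only.
This file is the pure real-analysis certificate behind every such row: for a convex `F` differentiable at `b`,
the left chord slope is a lower bound and the right chord slope an upper bound of `F'(b)` (Mathlib
`ConvexOn.slope_le_of_hasDerivAt` / `ConvexOn.le_slope_of_hasDerivAt`), and the same holds with the chord
endpoints replaced by the pessimistic ends of certified enclosures (`secant_bracket_of_enclosures`), optionally divided
by a positive normalisation `N` (`secant_bracket_div`).  Finite real analysis; no number, no row, no lattice object,
nothing about limits or a mass gap.

References: convexity of chord slopes [folklore]; the cell's FLOW-PLAN O7 / flow-ref FR-94 for the row protocol.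
-/

noncomputable section

namespace Summit.Ventures.YMGap.FlowData

namespace SecantConvex

variable {F : ℝ → ℝ} {S : Set ℝ} {b h₁ h₂ F' : ℝ}

/-- LEFT CHORD: for `F` convex on `S` and differentiable at `b ∈ S` with derivative `F'`, and `b - h₁ ∈ S`, `0 < h₁`,
the backward chord slope `(F b - F (b - h₁)) / h₁` is a LOWER bound of `F'`. [folklore] -/
theorem left_chord_le_deriv (hF : ConvexOn ℝ S F) (hb : b ∈ S) (hbh : b - h₁ ∈ S) (hh : 0 < h₁)
    (hd : HasDerivAt F F' b) : (F b - F (b - h₁)) / h₁ ≤ F' := by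
  have h := hF.slope_le_of_hasDerivAt hbh hb (by linarith) hd
  have hs : slope F (b - h₁) b = (F b - F (b - h₁)) / h₁ := by
    rw [slope_def_field]
    congr 1
    ring
  rw [hs] at h
  exact h

/-- RIGHT CHORD: for `F` convex on `S` and differentiable at `b ∈ S` with derivative `F'`, and `b + h₂ ∈ S`, `0 < h₂`,
the forward chord slope `(F (b + h₂) - F b) / h₂` is an UPPER bound of `F'`. [folklore] -/
theorem deriv_le_right_chord (hF : ConvexOn ℝ S F) (hb : b ∈ S) (hbh : b + h₂ ∈ S) (hh : 0 < h₂)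
    (hd : HasDerivAt F F' b) : F' ≤ (F (b + h₂) - F b) / h₂ := by
  have h := hF.le_slope_of_hasDerivAt hb hbh (by linarith) hd
  have hs : slope F b (b + h₂) = (F (b + h₂) - F b) / h₂ := by
    rw [slope_def_field]
    congr 1
    ring
  rw [hs] at h
  exact h

/-- SECANT-CONVEX CERTIFICATE FROM ENCLOSURES: if in addition only certified enclosures of the three function values
are known — `F (b - h₁) ≤ Ahi`, `Blo ≤ F b`, `F (b + h₂) ≤ Chi` (only these THREE ends matter: the upper ends of
the shifted values and the LOWER end of the centre value; the other three ends are irrelevant) — then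
`(Blo - Ahi) / h₁ ≤ F' ≤ (Chi - Blo) / h₂`: the pessimistic chords still bracket the derivative.  This is exactly the arithmetic of the rows (lineage B `secant.py`, lineage A
`plaq_secant.py`). [folklore] -/
theorem secant_bracket_of_enclosures {Ahi Blo Chi : ℝ} (hF : ConvexOn ℝ S F) (hb : b ∈ S)
    (hb₁ : b - h₁ ∈ S) (hb₂ : b + h₂ ∈ S) (hh₁ : 0 < h₁) (hh₂ : 0 < h₂) (hd : HasDerivAt F F' b)
    (hA : F (b - h₁) ≤ Ahi) (hBlo : Blo ≤ F b) (hC : F (b + h₂) ≤ Chi) :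
    (Blo - Ahi) / h₁ ≤ F' ∧ F' ≤ (Chi - Blo) / h₂ := by
  constructor
  · calc (Blo - Ahi) / h₁ ≤ (F b - F (b - h₁)) / h₁ := by
          apply div_le_div_of_nonneg_right _ hh₁.le
          linarith
      _ ≤ F' := left_chord_le_deriv hF hb hb₁ hh₁ hd
  · calc F' ≤ (F (b + h₂) - F b) / h₂ := deriv_le_right_chord hF hb hb₂ hh₂ hd
      _ ≤ (Chi - Blo) / h₂ := by
          apply div_le_div_of_nonneg_right _ hh₂.le
          linarith

/-- The normalised form used in the rows: with `P := F' / N` for a positive count `N` (the number of temporal or of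
spatial plaquettes per time slice), the enclosure-chords divided by `N` bracket `P`. [folklore] -/
theorem secant_bracket_div {Ahi Blo Chi N : ℝ} (hF : ConvexOn ℝ S F) (hb : b ∈ S)
    (hb₁ : b - h₁ ∈ S) (hb₂ : b + h₂ ∈ S) (hh₁ : 0 < h₁) (hh₂ : 0 < h₂) (hd : HasDerivAt F F' b)
    (hA : F (b - h₁) ≤ Ahi) (hBlo : Blo ≤ F b) (hC : F (b + h₂) ≤ Chi) (hN : 0 < N) :
    (Blo - Ahi) / h₁ / N ≤ F' / N ∧ F' / N ≤ (Chi - Blo) / h₂ / N := by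
  obtain ⟨h1, h2⟩ := secant_bracket_of_enclosures hF hb hb₁ hb₂ hh₁ hh₂ hd hA hBlo hC
  exact ⟨div_le_div_of_nonneg_right h1 hN.le, div_le_div_of_nonneg_right h2 hN.le⟩

/-- BEST-OF-SEVERAL CHORDS: lower bounds from several left chords and upper bounds from several right chords combine
by `max` / `min` (used when a lineage samples more than one step on each side). [folklore] -/
theorem deriv_mem_Icc_of_chords {L₁ L₂ U₁ U₂ : ℝ} (hL₁ : L₁ ≤ F') (hL₂ : L₂ ≤ F') (hU₁ : F' ≤ U₁) (hU₂ : F' ≤ U₂) :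
    F' ∈ Set.Icc (max L₁ L₂) (min U₁ U₂) :=
  ⟨max_le hL₁ hL₂, le_min hU₁ hU₂⟩

end SecantConvex

end Summit.Ventures.YMGap.FlowData
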